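import Mathlib.Analysis.InnerProductSpace.PiL2
import Mathlib.Analysis.Normed.Group.InfiniteSum
import Mathlib.Topology.Algebra.InfiniteSum.Real
import Mathlib.Topology.Algebra.InfiniteSum.NatInt
import Literature.MathematicalPhysics.StatisticalMechanics.HaggStacking
import Literature.MathematicalPhysics.StatisticalMechanics.BarlowStacking
import HarnessLib

/-!
# Layer decomposition of the energy of a Barlow stacking

Definition request `defn-BarlowStacking` (topic `StatisticalMechanics`, wanted by
`stmt-AtomisticToContinuum-0628` "stacking selection"), part (3) of its API: the point sets
`barlowStacking a h s` and their periodic structure are in `BarlowStacking.lean`, the abstract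
stacking functional `∑ J_k · 1[aligned]` in `HaggStacking.lean`; this file supplies the
**interlayer couplings `J_k(a, h)` of a pair potential `V`** and the identity
"energy per particle `= e₀(a,h) + ∑_{k ≥ 2} J_k(a,h) · (frequency of aligned pairs of layers at
distance `k`)".

Fix a pair potential `V : ℝ → ℝ`, the in-layer spacing `a`, the layer spacing `h`, and the vectors
`u = triangularVec₁ a`, `v = triangularVec₂ a`, `w = barlowOffset a`, `h e₃ = layerNormal h` of
`BarlowStacking.lean`. A particle of layer `m` sees layer `m + k` as the translate
`ℤu + ℤv + δ w + k h e₃` of the triangular lattice, where `δ = L(m+k) − L(m)` is the difference of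
the layer labels (`haggLabel`); its interaction with that layer is the lattice sum

* `layerInteraction V a h δ k = ∑'_{(i,j) ∈ ℤ²} V ‖i u + j v + δ w + k h e₃‖`,

which depends on `δ` only through `δ mod 3` (`3w = u + v`) and is the same for `δ ≡ 1` and
`δ ≡ 2 ≡ −1` (inversion symmetry of the triangular lattice), and is even in `k`
(`layerInteraction_eq_ite`). Hence only two values per distance occur — the **aligned** one
`Φ_A(k) = layerInteraction V a h 0 k` and the **non-aligned** one `Φ_N(k) = layerInteraction V a h 1 k`
— and

* `barlowCoupling V a h k = J_k(a,h) = Φ_A(k) − Φ_N(k)` (aligned minus non-aligned),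
* `barlowBaseEnergy V a h = e₀(a,h) = ½ Φ₀ + ∑_{k ≥ 1} Φ_N(k)` (`Φ₀ = inLayerInteraction V a`, the
  punctured in-layer sum),
* `barlowSiteEnergy V a h s m = ½ ∑_{y ≠ x} V(|x − y|)` over the points `y` of the stacking, for
  `x` a point of layer `m`, the sum being organised layer by layer (in-layer, layers above,
  layers below),
* `alignedFrequency s p k = p⁻¹ · #{0 ≤ m < p : layers m, m+k aligned}`,
* `haggBackwardLocalEnergy J s m = ∑'_{k ≥ 2} J_k · 1[aligned(m − k, m)]` (the layers below;
  `haggLocalEnergy` of `HaggStacking.lean` looks at the layers above).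

## Main results (all proved, [folklore])

* `layerInteraction_add_three_mul`, `layerInteraction_neg`, `layerInteraction_neg_offset`,
  `layerInteraction_eq_ite : layerInteraction δ k = if δ % 3 = 0 then Φ_A(k) else Φ_N(k)`;
* `tsum_layer_above`, `tsum_layer_below`: the interaction of a point of layer `m` with layer
  `m ± k` is `Φ_A(k)` or `Φ_N(k)` according as `HaggAligned s m k` (resp. `HaggAligned s (m-k) k`);
* `barlowSiteEnergy_eq` : for a Hägg sequence and summable layer interactions,
  `barlowSiteEnergy m = e₀ + ½ (haggLocalEnergy J s m + haggBackwardLocalEnergy J s m)`,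
  `J = barlowCoupling V a h`;
* `sum_range_haggBackwardLocalEnergy` : over a period of a `p`-periodic sequence the backward
  energies sum to `haggEnergy p J s`; `sum_range_barlowSiteEnergy : ∑_{m<p} site m = p e₀ + H_p`;
* `barlowSiteEnergy_average_eq_haggEnergy` : for a `p`-periodic Hägg sequence the energy per
  particle of a period, `p⁻¹ ∑_{m<p} barlowSiteEnergy m`, equals
  `e₀ + p⁻¹ · haggEnergy p (barlowCoupling V a h) s`;
* `barlowSiteEnergy_average_eq_tsum_alignedFrequency` : the same quantity equals
  `e₀ + ∑'_{k ≥ 2} J_k(a,h) · alignedFrequency s p k` — the formula of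
  `stmt-AtomisticToContinuum-0628`.

Not proved here: the identification of `p⁻¹ ∑_{m<p} barlowSiteEnergy V a h s m` with
`(barlowPeriodicConfiguration s ha hh hp hs).energyPerParticle V` of `Crystallization.lean`
(a regrouping of the absolutely convergent sum over the point set `barlowStacking a h s` by layers,
using `barlowPeriodicConfiguration_points`); the decay `|J_k| ≤ C k⁻⁴` for Lennard-Jones and the
sign/domination inequalities of `0628` are the route's (certified-numerics) business.

## References

The layer-by-layer bookkeeping is elementary ([folklore]); the framing as a one-dimensional model
with couplings between layers at distance `k` is that of the ANNNI/A3NNI description of polytypism: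

* L. B. Pártay, C. Ortner, A. P. Bartók, C. J. Pickard, G. Csányi, *Polytypism in the ground state
  structure of the Lennard-Jonesium*, PCCP 19 (2017), §1 and Appendix A. arXiv:1705.01751.
* X. Blanc, M. Lewin, *The crystallization conjecture: a review*, EMS Surv. Math. Sci. 2 (2015),
  §2.1 (17)–(18) (periodic configurations, HCP as two shifted Bravais lattices) and §2.5 (23)
  (energy per particle `½ ∑_{g ∈ G ∖ {0}} V(g)` of a lattice; `barlowSiteEnergy` is its
  multi-lattice analogue `½ ∑_{y ≠ x} V(|x − y|)`). arXiv:1504.01153.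
-/

noncomputable section

open Finset

namespace Literature.MathematicalPhysics.StatisticalMechanics

/-! ## Interaction of a particle with a shifted triangular layer -/

section LayerSums

variable (V : ℝ → ℝ) (a h : ℝ)

/-- The vector `i u + j v + δ w + k h e₃` from a particle to the point `(i, j)` of a triangular
layer at signed layer distance `k`, laterally offset by `δ` letters (`A → B → C → A` is `δ = 1`).
[folklore] -/
def layerVec (δ k i j : ℤ) : EuclideanSpace ℝ (Fin 3) :=
  (i : ℝ) • triangularVec₁ a + (j : ℝ) • triangularVec₂ a + (δ : ℝ) • barlowOffset a +
    (k : ℝ) • layerNormal h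

/-- **The interaction of a particle with a full triangular layer** at signed layer distance `k`
and lateral letter offset `δ`: the lattice sum `∑'_{(i,j) ∈ ℤ²} V ‖i u + j v + δ w + k h e₃‖`
(a `tsum`, junk value `0` if not summable). [folklore] -/
def layerInteraction (δ k : ℤ) : ℝ :=
  ∑' ij : ℤ × ℤ, V ‖layerVec a h δ k ij.1 ij.2‖

/-- **The punctured in-layer sum** `Φ₀ = ∑_{(i,j) ≠ 0} V ‖i u + j v‖`: interaction of a particle
with the rest of its own layer. [folklore] -/
def inLayerInteraction : ℝ :=
  ∑' ij : ℤ × ℤ,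
    if ij = 0 then 0 else V ‖(ij.1 : ℝ) • triangularVec₁ a + (ij.2 : ℝ) • triangularVec₂ a‖

/-- **The interlayer coupling `J_k(a, h)`** of the pair potential `V` at layer distance `k`:
aligned minus non-aligned layer interaction, `Φ_A(k) − Φ_N(k)`. [folklore] -/
def barlowCoupling (k : ℕ) : ℝ :=
  layerInteraction V a h 0 k - layerInteraction V a h 1 k

/-- **The stacking-independent part `e₀(a, h)`** of the energy per particle of a Barlow stacking:
`½ Φ₀ + ∑_{k ≥ 1} Φ_N(k)` (half the in-layer energy, plus the non-aligned interaction with every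
layer above; the layers below contribute the same, which cancels the factor `½`). [folklore] -/
def barlowBaseEnergy : ℝ :=
  (1 / 2) * inLayerInteraction V a + ∑' k : ℕ, layerInteraction V a h 1 (k + 1 : ℕ)

variable (s : ℤ → ℤ)

/-- **The energy of a site of layer `m`** of the Barlow stacking coded by `s`: half the sum of
`V(|x − y|)` over all points `y ≠ x` of the stacking, `x = barlowPos a h s m 0 0`, organised as
(punctured layer `m`) + (layers `m + 1, m + 2, …`) + (layers `m − 1, m − 2, …`), each layer sum and
the sums over layers being `tsum`s. By the in-layer translations the value is the same for every
point of layer `m`. This is the multi-lattice analogue of the lattice energy per particle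
`½ ∑_{g ∈ G ∖ {0}} V(g)`. [cite: BlancLewin2015, §2.5 (23)] -/
def barlowSiteEnergy (m : ℤ) : ℝ :=
  (1 / 2) * ((∑' ij : ℤ × ℤ, if ij = 0 then 0 else
      V (dist (barlowPos a h s m 0 0) (barlowPos a h s m ij.1 ij.2))) +
    (∑' k : ℕ, ∑' ij : ℤ × ℤ,
      V (dist (barlowPos a h s m 0 0) (barlowPos a h s (m + (k + 1 : ℕ)) ij.1 ij.2))) +
    ∑' k : ℕ, ∑' ij : ℤ × ℤ,
      V (dist (barlowPos a h s m 0 0) (barlowPos a h s (m - (k + 1 : ℕ)) ij.1 ij.2)))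

/-- **The frequency of aligned pairs at layer distance `k`** in a period of length `p`:
`p⁻¹ · #{0 ≤ m < p : layers m and m + k aligned}`. [folklore] -/
def alignedFrequency (p k : ℕ) : ℝ :=
  (((range p).filter fun m : ℕ => HaggAligned s m k).card : ℝ) / p

/-- **The backward local energy at layer `m`**: `∑'_{k ≥ 2} J_k · 1[layers m − k, m aligned]`
(companion of `haggLocalEnergy`, which looks at the layers `m + k` above). Over a period the two
have the same sum (`sum_range_haggBackwardLocalEnergy`). [folklore] -/
def haggBackwardLocalEnergy (J : ℕ → ℝ) (s : ℤ → ℤ) (m : ℤ) : ℝ :=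
  ∑' k : ℕ, if 2 ≤ k ∧ HaggAligned s (m - k) k then J k else 0

end LayerSums

/-! ## Symmetries of the layer interaction -/

section Symmetry

variable (V : ℝ → ℝ) (a h : ℝ)

/-- Coordinates of `layerVec`. [folklore] -/
@[simp] theorem layerVec_apply_zero (δ k i j : ℤ) :
    layerVec a h δ k i j 0 = a * (i + j / 2 + δ / 2) := by
  simp [layerVec, triangularVec₁, triangularVec₂, barlowOffset, layerNormal]; ring

/-- Coordinates of `layerVec`. [folklore] -/
@[simp] theorem layerVec_apply_one (δ k i j : ℤ) :
    layerVec a h δ k i j 1 = a * √3 / 2 * (j + δ / 3) := by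
  simp [layerVec, triangularVec₁, triangularVec₂, barlowOffset, layerNormal]; ring

/-- Coordinates of `layerVec`. [folklore] -/
@[simp] theorem layerVec_apply_two (δ k i j : ℤ) : layerVec a h δ k i j 2 = k * h := by
  simp [layerVec, triangularVec₁, triangularVec₂, barlowOffset, layerNormal]

/-- The norm of `layerVec` in coordinates. [folklore] -/
theorem norm_layerVec (δ k i j : ℤ) :
    ‖layerVec a h δ k i j‖ =
      √((a * (i + j / 2 + δ / 2)) ^ 2 + (a * √3 / 2 * (j + δ / 3)) ^ 2 + (k * h) ^ 2) := by
  rw [EuclideanSpace.norm_eq, Fin.sum_univ_three, Real.norm_eq_abs, Real.norm_eq_abs,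
    Real.norm_eq_abs, sq_abs, sq_abs, sq_abs, layerVec_apply_zero, layerVec_apply_one,
    layerVec_apply_two]

/-- In-layer vectors: `layerVec a h 0 0 i j = i u + j v`. [folklore] -/
theorem layerVec_zero_zero (i j : ℤ) :
    layerVec a h 0 0 i j = (i : ℝ) • triangularVec₁ a + (j : ℝ) • triangularVec₂ a := by
  simp [layerVec]

/-- Differences of stacking points are `layerVec`s. [folklore] -/
theorem barlowPos_sub_barlowPos (s : ℤ → ℤ) (k i j k' i' j' : ℤ) :
    barlowPos a h s k' i' j' - barlowPos a h s k i j =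
      layerVec a h (haggLabel s k' - haggLabel s k) (k' - k) (i' - i) (j' - j) := by
  simp only [barlowPos, layerVec, Int.cast_sub]
  module

/-- Distances of stacking points are norms of `layerVec`s. [folklore] -/
theorem dist_barlowPos_eq_norm_layerVec (s : ℤ → ℤ) (k i j k' i' j' : ℤ) :
    dist (barlowPos a h s k i j) (barlowPos a h s k' i' j') =
      ‖layerVec a h (haggLabel s k' - haggLabel s k) (k' - k) (i' - i) (j' - j)‖ := by
  rw [dist_comm, dist_eq_norm, barlowPos_sub_barlowPos]

/-- `3 w = u + v`: shifting the offset by `3q` letters is the reindexing `(i, j) ↦ (i + q, j + q)`.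
[folklore] -/
theorem norm_layerVec_add_three_mul (δ q k i j : ℤ) :
    ‖layerVec a h (δ + 3 * q) k i j‖ = ‖layerVec a h δ k (i + q) (j + q)‖ := by
  rw [norm_layerVec, norm_layerVec]
  congr 1
  push_cast
  ring

/-- Inversion: `‖layerVec (−δ) (−k) (−i) (−j)‖ = ‖layerVec δ k i j‖`. [folklore] -/
theorem norm_layerVec_neg (δ k i j : ℤ) :
    ‖layerVec a h (-δ) (-k) (-i) (-j)‖ = ‖layerVec a h δ k i j‖ := by
  rw [norm_layerVec, norm_layerVec]
  congr 1
  push_cast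
  ring

/-- Reflection in the layer plane: `‖layerVec δ (−k) i j‖ = ‖layerVec δ k i j‖`. [folklore] -/
theorem norm_layerVec_neg_layer (δ k i j : ℤ) :
    ‖layerVec a h δ (-k) i j‖ = ‖layerVec a h δ k i j‖ := by
  rw [norm_layerVec, norm_layerVec]
  congr 1
  push_cast
  ring

/-- **`layerInteraction` depends on the offset only modulo `3`.** [folklore] -/
theorem layerInteraction_add_three_mul (δ q k : ℤ) :
    layerInteraction V a h (δ + 3 * q) k = layerInteraction V a h δ k := by
  unfold layerInteraction
  rw [← Equiv.tsum_eq (Equiv.addRight ((q, q) : ℤ × ℤ)) fun ij : ℤ × ℤ =>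
    V ‖layerVec a h δ k ij.1 ij.2‖]
  refine tsum_congr fun ij => ?_
  rw [norm_layerVec_add_three_mul]
  rfl

/-- **`layerInteraction` is even in the layer distance.** [folklore] -/
theorem layerInteraction_neg_layer (δ k : ℤ) :
    layerInteraction V a h δ (-k) = layerInteraction V a h δ k := by
  unfold layerInteraction
  exact tsum_congr fun ij => by rw [norm_layerVec_neg_layer]

/-- Inversion symmetry: `layerInteraction (−δ) (−k) = layerInteraction δ k`. [folklore] -/
theorem layerInteraction_neg (δ k : ℤ) :
    layerInteraction V a h (-δ) (-k) = layerInteraction V a h δ k := by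
  unfold layerInteraction
  rw [← Equiv.tsum_eq (Equiv.neg (ℤ × ℤ)) fun ij : ℤ × ℤ =>
    V ‖layerVec a h (-δ) (-k) ij.1 ij.2‖]
  refine tsum_congr fun ij => ?_
  simp only [Equiv.neg_apply, Prod.fst_neg, Prod.snd_neg]
  rw [norm_layerVec_neg]

/-- **`layerInteraction` is even in the offset**: offsets `B` (`δ ≡ 1`) and `C` (`δ ≡ 2 ≡ −1`)
relative to `A` give the same interaction. [folklore] -/
theorem layerInteraction_neg_offset (δ k : ℤ) :
    layerInteraction V a h (-δ) k = layerInteraction V a h δ k := by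
  rw [← layerInteraction_neg_layer V a h (-δ) k, layerInteraction_neg]

/-- **Only two values occur**: `layerInteraction δ k` is the aligned value `Φ_A(k)` if `3 ∣ δ` and
the non-aligned value `Φ_N(k)` otherwise. [folklore] -/
theorem layerInteraction_eq_ite (δ k : ℤ) :
    layerInteraction V a h δ k =
      if δ % 3 = 0 then layerInteraction V a h 0 k else layerInteraction V a h 1 k := by
  have hδ : δ = δ % 3 + 3 * (δ / 3) := (Int.emod_add_mul_ediv δ 3).symm
  have h0 : 0 ≤ δ % 3 := Int.emod_nonneg δ (by norm_num)
  have h3 : δ % 3 < 3 := Int.emod_lt_of_pos δ (by norm_num)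
  conv_lhs => rw [hδ, layerInteraction_add_three_mul]
  split_ifs with hr
  · rw [hr]
  · rcases (show δ % 3 = 1 ∨ δ % 3 = 2 by omega) with h1 | h2
    · rw [h1]
    · rw [h2, show (2 : ℤ) = -1 + 3 * 1 by norm_num, layerInteraction_add_three_mul,
        layerInteraction_neg_offset]

end Symmetry

/-! ## The layer sums of a stacking -/

section Stacking

variable (V : ℝ → ℝ) (a h : ℝ) (s : ℤ → ℤ)

/-- The interaction of the base point of layer `m` with the whole layer `k'` is
`layerInteraction (L k' − L m) (k' − m)`. [folklore] -/
theorem tsum_layer (m k' : ℤ) :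
    ∑' ij : ℤ × ℤ, V (dist (barlowPos a h s m 0 0) (barlowPos a h s k' ij.1 ij.2)) =
      layerInteraction V a h (haggLabel s k' - haggLabel s m) (k' - m) := by
  unfold layerInteraction
  exact tsum_congr fun ij => by rw [dist_barlowPos_eq_norm_layerVec, sub_zero, sub_zero]

/-- The punctured in-layer sum of the stacking is `Φ₀ = inLayerInteraction V a`. [folklore] -/
theorem tsum_inLayer (m : ℤ) :
    ∑' ij : ℤ × ℤ, (if ij = 0 then 0 else
      V (dist (barlowPos a h s m 0 0) (barlowPos a h s m ij.1 ij.2))) = inLayerInteraction V a := by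
  unfold inLayerInteraction
  refine tsum_congr fun ij => ?_
  rw [dist_barlowPos_eq_norm_layerVec, sub_self, sub_self, sub_zero, sub_zero, layerVec_zero_zero]

/-- **Interaction with layer `m + k`**: `Φ_A(k)` if `HaggAligned s m k`, else `Φ_N(k)`.
[folklore] -/
theorem tsum_layer_above (m : ℤ) (k : ℕ) :
    ∑' ij : ℤ × ℤ, V (dist (barlowPos a h s m 0 0) (barlowPos a h s (m + k) ij.1 ij.2)) =
      if HaggAligned s m k then layerInteraction V a h 0 k else layerInteraction V a h 1 k := by
  rw [tsum_layer, haggLabel_add_natCast, add_sub_cancel_left, add_sub_cancel_left,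
    layerInteraction_eq_ite]

/-- **Interaction with layer `m − k`**: `Φ_A(k)` if `HaggAligned s (m − k) k`, else `Φ_N(k)`.
[folklore] -/
theorem tsum_layer_below (m : ℤ) (k : ℕ) :
    ∑' ij : ℤ × ℤ, V (dist (barlowPos a h s m 0 0) (barlowPos a h s (m - k) ij.1 ij.2)) =
      if HaggAligned s (m - k) k then layerInteraction V a h 0 k
      else layerInteraction V a h 1 k := by
  have hL : haggLabel s (m - k) - haggLabel s m = -haggWindow s (m - k) k := by
    have := haggLabel_add_natCast s (m - k) k
    rw [sub_add_cancel] at this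
    linarith
  rw [tsum_layer, hL, show m - (k : ℤ) - m = -(k : ℤ) by ring, layerInteraction_neg,
    layerInteraction_eq_ite]

/-- `Φ_A / Φ_N` selection as `Φ_N + J_k · 1[aligned]`. [folklore] -/
theorem ite_layerInteraction_eq (P : Prop) [Decidable P] (k : ℕ) :
    (if P then layerInteraction V a h 0 k else layerInteraction V a h 1 k) =
      layerInteraction V a h 1 k + if P then barlowCoupling V a h k else 0 := by
  unfold barlowCoupling
  split_ifs <;> ring

variable {s}

/-- Consecutive layers are never aligned (`s m = ±1`). [folklore] -/
theorem not_haggAligned_one (hs : IsHaggSeq s) (m : ℤ) : ¬ HaggAligned s m 1 := by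
  simp only [HaggAligned, haggWindow, sum_range_one, Nat.cast_zero, add_zero]
  rcases hs m with h1 | h1 <;> rw [h1] <;> decide

/-- A masked summable sequence is summable. [folklore] -/
theorem summable_ite_of_summable {J : ℕ → ℝ} (hJ : Summable J) (P : ℕ → Prop)
    [DecidablePred P] : Summable fun k => if P k then J k else 0 := by
  have : (fun k => if P k then J k else 0) = Set.indicator {k | P k} J := by
    ext k
    by_cases hk : P k <;> simp [hk]
  rw [this]
  exact hJ.indicator _

/-- Reindexing `k ↦ k + 1` of a sum whose `k = 0, 1` terms vanish. [folklore] -/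
theorem tsum_ite_succ_eq {P : ℕ → Prop} [DecidablePred P] (hP : ¬ P 1) (J : ℕ → ℝ) :
    ∑' k : ℕ, (if P (k + 1) then J (k + 1) else 0) =
      ∑' k : ℕ, if 2 ≤ k ∧ P k then J k else 0 := by
  have h1 : ∑' k : ℕ, (if 2 ≤ k + 1 ∧ P (k + 1) then J (k + 1) else 0) =
      ∑' k : ℕ, if 2 ≤ k ∧ P k then J k else 0 :=
    Function.Injective.tsum_eq (g := fun k : ℕ => k + 1)
      (f := fun k : ℕ => if 2 ≤ k ∧ P k then J k else 0) (add_left_injective 1) (by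
        intro k hk
        have hk0 : k ≠ 0 := by
          rintro rfl
          simp at hk
        exact ⟨k - 1, by simp only; omega⟩)
  rw [← h1]
  refine tsum_congr fun k => ?_
  rcases k with _ | n
  · simp [hP]
  · simp [show 2 ≤ n + 1 + 1 by omega]

/-- **The energy of a site, layer by layer.** For a Hägg sequence `s` and summable aligned and
non-aligned layer interactions,
`barlowSiteEnergy m = e₀ + ½ (∑'_{k ≥ 2} J_k 1[aligned(m, m+k)] + ∑'_{k ≥ 2} J_k 1[aligned(m−k, m)])`
(the adjacent layers `m ± 1` are never aligned and sit in `e₀`). [folklore] -/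
theorem barlowSiteEnergy_eq (hs : IsHaggSeq s)
    (hA : Summable fun k : ℕ => layerInteraction V a h 0 k)
    (hN : Summable fun k : ℕ => layerInteraction V a h 1 k) (m : ℤ) :
    barlowSiteEnergy V a h s m = barlowBaseEnergy V a h +
      (1 / 2) * (haggLocalEnergy (barlowCoupling V a h) s m +
        haggBackwardLocalEnergy (barlowCoupling V a h) s m) := by
  have hJ : Summable fun k : ℕ => barlowCoupling V a h k := hA.sub hN
  have hN1 : Summable fun k : ℕ => layerInteraction V a h 1 ((k + 1 : ℕ) : ℤ) :=
    (summable_nat_add_iff (f := fun k : ℕ => layerInteraction V a h 1 k) 1).2 hN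
  have hF : Summable fun k : ℕ =>
      if HaggAligned s m (k + 1) then barlowCoupling V a h (k + 1) else 0 :=
    (summable_nat_add_iff
      (f := fun k : ℕ => if HaggAligned s m k then barlowCoupling V a h k else 0) 1).2
      (summable_ite_of_summable hJ _)
  have hB : Summable fun k : ℕ =>
      if HaggAligned s (m - (k + 1 : ℕ)) (k + 1) then barlowCoupling V a h (k + 1) else 0 :=
    (summable_nat_add_iff
      (f := fun k : ℕ => if HaggAligned s (m - k) k then barlowCoupling V a h k else 0) 1).2
      (summable_ite_of_summable hJ _)
  have eF : ∑' k : ℕ, (if HaggAligned s m (k + 1) then barlowCoupling V a h (k + 1) else 0) =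
      haggLocalEnergy (barlowCoupling V a h) s m :=
    tsum_ite_succ_eq (P := fun k => HaggAligned s m k) (not_haggAligned_one hs m) _
  have eB : ∑' k : ℕ,
      (if HaggAligned s (m - (k + 1 : ℕ)) (k + 1) then barlowCoupling V a h (k + 1) else 0) =
      haggBackwardLocalEnergy (barlowCoupling V a h) s m :=
    tsum_ite_succ_eq (P := fun k : ℕ => HaggAligned s (m - k) k) (not_haggAligned_one hs _) _
  simp only [barlowSiteEnergy, tsum_inLayer, tsum_layer_above, tsum_layer_below,
    ite_layerInteraction_eq]
  rw [hN1.tsum_add hF, hN1.tsum_add hB, eF, eB, barlowBaseEnergy]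
  ring

/-! ## Periodic stackings: energy per particle -/

/-- A sum over a full period is invariant under the shift `m ↦ m − k`. [folklore] -/
theorem sum_range_sub_of_periodic {f : ℤ → ℝ} {p : ℕ} (hf : ∀ m, f (m + p) = f m) (k : ℕ) :
    ∑ m ∈ range p, f ((m : ℤ) - k) = ∑ m ∈ range p, f m := by
  induction k with
  | zero => simp
  | succ k ih =>
    rw [← ih]
    have h1 : ∑ m ∈ range p, f ((m : ℤ) + 1 - (k + 1 : ℕ)) =
        ∑ m ∈ range p, f ((m : ℤ) - (k + 1 : ℕ)) :=
      sum_range_shift_of_periodic (f := fun m => f (m - (k + 1 : ℕ))) (n := p) fun m => by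
        show f (m + p - (k + 1 : ℕ)) = f (m - (k + 1 : ℕ))
        rw [show m + p - ((k + 1 : ℕ) : ℤ) = m - (k + 1 : ℕ) + p by ring, hf]
    rw [← h1]
    refine sum_congr rfl fun m _ => ?_
    congr 1
    push_cast
    ring

/-- **Over a period, backward and forward stacking energies agree**:
`∑_{m<p} ∑'_{k ≥ 2} J_k 1[aligned(m−k, m)] = H_p(J, s)` for `p`-periodic `s` and summable `J`.
[folklore] -/
theorem sum_range_haggBackwardLocalEnergy {p : ℕ} (hp : ∀ i, s (i + p) = s i) {J : ℕ → ℝ}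
    (hJ : Summable J) :
    ∑ m ∈ range p, haggBackwardLocalEnergy J s m = haggEnergy p J s := by
  unfold haggBackwardLocalEnergy haggEnergy haggLocalEnergy
  rw [← Summable.tsum_finsetSum (fun m _ => summable_ite_of_summable hJ _),
    ← Summable.tsum_finsetSum (fun m _ => summable_ite_of_summable hJ _)]
  refine tsum_congr fun k => ?_
  exact sum_range_sub_of_periodic
    (f := fun m : ℤ => if 2 ≤ k ∧ HaggAligned s m k then J k else 0)
    (fun m => by simp only [HaggAligned, haggWindow_periodic hp]) k

/-- **The energy of a period**: `∑_{m<p} barlowSiteEnergy m = p · e₀ + H_p(J, s)` with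
`J = barlowCoupling V a h`, for a `p`-periodic Hägg sequence. [folklore] -/
theorem sum_range_barlowSiteEnergy (hs : IsHaggSeq s) {p : ℕ} (hp : ∀ i, s (i + p) = s i)
    (hA : Summable fun k : ℕ => layerInteraction V a h 0 k)
    (hN : Summable fun k : ℕ => layerInteraction V a h 1 k) :
    ∑ m ∈ range p, barlowSiteEnergy V a h s m =
      p * barlowBaseEnergy V a h + haggEnergy p (barlowCoupling V a h) s := by
  have hJ : Summable fun k : ℕ => barlowCoupling V a h k := hA.sub hN
  simp only [barlowSiteEnergy_eq V a h hs hA hN, sum_add_distrib, sum_const, card_range,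
    nsmul_eq_mul, ← mul_sum]
  rw [sum_range_haggBackwardLocalEnergy hp hJ, haggEnergy]
  ring

/-- **Energy per particle of a periodic stacking, I**: for a `p`-periodic Hägg sequence
(`0 < p`), `p⁻¹ ∑_{m<p} barlowSiteEnergy m = e₀(a,h) + p⁻¹ H_p(barlowCoupling V a h, s)` — the
stacking-dependent part is the functional `haggEnergy` of `HaggStacking.lean`. [folklore] -/
theorem barlowSiteEnergy_average_eq_haggEnergy (hs : IsHaggSeq s) {p : ℕ} (hp0 : p ≠ 0)
    (hp : ∀ i, s (i + p) = s i)
    (hA : Summable fun k : ℕ => layerInteraction V a h 0 k)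
    (hN : Summable fun k : ℕ => layerInteraction V a h 1 k) :
    (∑ m ∈ range p, barlowSiteEnergy V a h s m) / p =
      barlowBaseEnergy V a h + haggEnergy p (barlowCoupling V a h) s / p := by
  rw [sum_range_barlowSiteEnergy V a h hs hp hA hN, add_div,
    mul_div_cancel_left₀ _ (Nat.cast_ne_zero.2 hp0)]

/-- `p⁻¹ H_p(J, s) = ∑'_{k ≥ 2} J_k · alignedFrequency s p k` for summable `J`. [folklore] -/
theorem haggEnergy_div_eq_tsum_alignedFrequency (s : ℤ → ℤ) {p : ℕ} {J : ℕ → ℝ}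
    (hJ : Summable J) :
    haggEnergy p J s / p = ∑' k : ℕ, if 2 ≤ k then J k * alignedFrequency s p k else 0 := by
  unfold haggEnergy haggLocalEnergy alignedFrequency
  rw [← Summable.tsum_finsetSum (fun m _ => summable_ite_of_summable hJ _), ← tsum_div_const]
  refine tsum_congr fun k => ?_
  by_cases hk : 2 ≤ k
  · simp only [hk, true_and, if_true]
    rw [← sum_filter, sum_const, nsmul_eq_mul]
    ring
  · simp [hk]

/-- **Energy per particle of a periodic stacking, II** (the formula of
`stmt-AtomisticToContinuum-0628`): for a `p`-periodic Hägg sequence (`0 < p`) and summable layer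
interactions,
`p⁻¹ ∑_{m<p} barlowSiteEnergy m = e₀(a,h) + ∑'_{k ≥ 2} J_k(a,h) · alignedFrequency s p k`.
[folklore] -/
theorem barlowSiteEnergy_average_eq_tsum_alignedFrequency (hs : IsHaggSeq s) {p : ℕ}
    (hp0 : p ≠ 0) (hp : ∀ i, s (i + p) = s i)
    (hA : Summable fun k : ℕ => layerInteraction V a h 0 k)
    (hN : Summable fun k : ℕ => layerInteraction V a h 1 k) :
    (∑ m ∈ range p, barlowSiteEnergy V a h s m) / p =
      barlowBaseEnergy V a h +
        ∑' k : ℕ, if 2 ≤ k then barlowCoupling V a h k * alignedFrequency s p k else 0 := by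
  have hJ : Summable fun k : ℕ => barlowCoupling V a h k := hA.sub hN
  rw [barlowSiteEnergy_average_eq_haggEnergy V a h hs hp0 hp hA hN,
    haggEnergy_div_eq_tsum_alignedFrequency s hJ]

end Stacking

end Literature.MathematicalPhysics.StatisticalMechanics
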